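import Summits.AtomisticToContinuum.Crystallization.Theorems.FrustratedLawDichotomyStrainedPatchGradStep
import Summits.AtomisticToContinuum.Crystallization.Theorems.FrustratedLawDichotomyStrainedPatchGradedTube

/-!
# GradedDescent — the row-priced descent ON THE GRADED TUBE (lens-5 g78, «finite/base range + asymptotic regime + bridge»; part 1 of 2, part 2 = `…GradedStage`)

TARGET OF RECORD (27623 T-leaf) `CoreOffTubeFloor (63/10) (63/10) (24/5) (1/100) 0` **[CORE-FAR]**, reached through the graded AND-node of
`…GradedTube` (g77, in tree): `TubeFloorG 𝓘 τ T ∧ FamilyCoverG 𝓘 (24/5) (1/100) (1/8) τ T` at a scalar `τ` (rim / covering value) and a per-host-SITE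
tolerance table `T` (`coreOff_of_tubeFloorG_of_coverG_eighth`).  g77 typed the LEAVES; the certificate machinery of record — the row-priced descent
`tubeFloor_of_pricedCharge_of_tabDescent` (…RowPrice), its host tables `HostTopTab` / `HostStepTab`, and the LP stage format of …GradStep
(`HostDiffTab`, `HostPairTab`, `DiffEvalTab`, `PairEvalTab`, `StageCert`, START by the box table `boxTab τ = 2τ`) — still reads the UNIFORM box
`‖D h‖ ≤ τ` at every host site, so it cannot cash the grading.  These two modules thread the table through that machinery; this part:

* §0 `FineChartG T` — the chart's deviation field boxed PER HOST SITE, `‖dev a‖ ≤ T(z₀)(c₀)(e a)` (= the profile clause of `ChartByG`, in `dev`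
  form; `FineChart δ` is the constant table); `ChartByG ↔ ChartBy ∧ FineChartG` [PROVED].
* §1 the graded CLUSTER formats `PriceTopTabG`, `PriceStepTabG`, `SlackCertG` (one extra binder `FineChartG T`; the terminal certificate reads
  `ChartByG`, i.e. the census LP over tube ∩ graded box ∩ polytope) and ★★★ `tubeFloorG_of_pricedCharge_of_tabDescentG`:
  `PricedCharge` (UNGRADED — the tree's (C2L) / far / tail data serve unchanged) + graded START + graded stages + graded terminal ⟹ `TubeFloorG 𝓘 τ T`
  [PROVED, the induction of R1⁗ verbatim with the box carried along]; `coreOff_of_tabDescentG` [CORE-FAR] via g77's junction; every graded format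
  is ANTITONE in `T` and `↔` the format of record at `T = constTol τ` [PROVED], so R1⁗ is the constant-table instance (`tubeFloor_of_tabDescent_via_graded`).
* §2 the graded HOST READING `HostReadingG τ T` (`HostReading τ` ∧ `‖D h‖ ≤ T h` on the occupancy), ★ `hostReadingG_of_chart` [PROVED], the graded
  host tables `HostTopTabG` / `HostStepTabG` [INSTRUMENTABLE per host cell], their soundness ★★ `priceTopTabG_of_hostTopTabG` /
  `priceStepTabG_of_hostStepTabG` [PROVED], and ★★★ `tubeFloorG_of_hostTabsG` ((TF-G) from graded host tables + the general bond data of R1⁗).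

THE PIECES AND THEIR TAGS (both parts).  [CORE-FAR] ⟸ (BC-G) `FamilyCoverG … (1/100) T` [GEOMETRIC · INSTRUMENTABLE (census COVER-G) · UNDECIDED]
∧ (START-G) `DiffEvalTabG … (boxTabG T) (P 0)` [closed-form arithmetic · WEAKER than START at `τ`] ∧ (STAGE-G)ᵢ `StageCertG … (addCol X (P i)) (P (i+1))`
[LPs on the graded global polytope · INSTRUMENTABLE (census GRAD-77) · UNDECIDED] ∧ (CERT-G) `SlackCertG … (addCol X (P n))` [LP · INSTRUMENTABLE
(census CERT-G) · UNDECIDED] ∧ the R1⁗ data (HFAR, TAILCERT, host separation, `PairAdm`) [in tree / decidable].  Every certificate-side piece is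
WEAKER than its record counterpart for every `T` and equal to it at `T = constTol τ`; only the cover is STRONGER (g77's trade lemma).
LENS GRAMMAR.  Finite/base range = the host ball `R₀ ≤ R_g` at `τ_in`, where the START / stage / terminal LPs are decided (80 % of the dual mass of the
LP of record sits on `R₀ ∈ [1, 3]`); asymptotic regime = the rim `R_g < R₀ ≤ 63/10` at `τ_out = 1/100`, `X`-capped rows, cover-bound only; bridge = the
graded descent + g77's junction.  Which `(R_g, τ_in)` closes is the census's; Lean fixes no number.
Formal bookkeeping throughout (every proof is the record's with one binder threaded); every proof closed, axioms ⊆ {propext, Classical.choice, Quot.sound}, no instances / notation / options;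
zero edits to landed declarations.
-/

namespace Summit.AtomisticToContinuum.Crystallization.Theorems.FrustratedLawDichotomyStrainedPatchGradedDescent

open scoped BigOperators Classical
open Summit.AtomisticToContinuum.Crystallization.Theorems.FrustratedLawDichotomyMotifLemmas
open Summit.AtomisticToContinuum.Crystallization.Theorems.FrustratedLawDichotomyRangeCut
open Summit.AtomisticToContinuum.Crystallization.Theorems.FrustratedLawDichotomyAveragingCut
open Summit.AtomisticToContinuum.Crystallization.Theorems.FrustratedLawDichotomyStrainedPatchHomSplit
open Summit.AtomisticToContinuum.Crystallization.Theorems.FrustratedLawDichotomyStrainedPatchCleanCollar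
open Summit.AtomisticToContinuum.Crystallization.Theorems.FrustratedLawDichotomyStrainedPatchPhaseCut
open Summit.AtomisticToContinuum.Crystallization.Theorems.FrustratedLawDichotomyStrainedPatchCoreTube
open Summit.AtomisticToContinuum.Crystallization.Theorems.FrustratedLawDichotomyStrainedPatchStrainBands
open Summit.AtomisticToContinuum.Crystallization.Theorems.FrustratedLawDichotomyStrainedPatchHomIsometry
open Summit.AtomisticToContinuum.Crystallization.Theorems.FrustratedLawDichotomyStrainedPatchHomTubeIso
open Summit.AtomisticToContinuum.Crystallization.Theorems.FrustratedLawDichotomyStrainedPatchEnvelopeLaw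
open Summit.AtomisticToContinuum.Crystallization.Theorems.FrustratedLawDichotomyStrainedPatchEnvelopeTaylor
open Summit.AtomisticToContinuum.Crystallization.Theorems.FrustratedLawDichotomyStrainedPatchChartFamilies
open Summit.AtomisticToContinuum.Crystallization.Theorems.FrustratedLawDichotomyStrainedPatchChartFamiliesPinned
open Summit.AtomisticToContinuum.Crystallization.Theorems.FrustratedLawDichotomyStrainedPatchQuantSlaving
open Summit.AtomisticToContinuum.Crystallization.Theorems.FrustratedLawDichotomyStrainedPatchHostCells
open Summit.AtomisticToContinuum.Crystallization.Theorems.FrustratedLawDichotomyStrainedPatchForceCap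
open Summit.AtomisticToContinuum.Crystallization.Theorems.FrustratedLawDichotomyStrainedPatchTextureFloor
open Summit.AtomisticToContinuum.Crystallization.Theorems.FrustratedLawDichotomyStrainedPatchSVCharge
open Summit.AtomisticToContinuum.Crystallization.Theorems.FrustratedLawDichotomyStrainedPatchChargePrice
open Summit.AtomisticToContinuum.Crystallization.Theorems.FrustratedLawDichotomyStrainedPatchTaylorTop
open Summit.AtomisticToContinuum.Crystallization.Theorems.FrustratedLawDichotomyStrainedPatchTaylorCharge
open Summit.AtomisticToContinuum.Crystallization.Theorems.FrustratedLawDichotomyStrainedPatchHostStep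
open Summit.AtomisticToContinuum.Crystallization.Theorems.FrustratedLawDichotomyStrainedPatchBondCalculus
open Summit.AtomisticToContinuum.Crystallization.Theorems.FrustratedLawDichotomyStrainedPatchFarSplit
open Summit.AtomisticToContinuum.Crystallization.Theorems.FrustratedLawDichotomyStrainedPatchTailPacking
open Summit.AtomisticToContinuum.Crystallization.Theorems.FrustratedLawDichotomyStrainedPatchRimFold
open Summit.AtomisticToContinuum.Crystallization.Theorems.FrustratedLawDichotomyStrainedPatchRowPrice
open Summit.AtomisticToContinuum.Crystallization.Theorems.FrustratedLawDichotomyStrainedPatchGradStep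
open Summit.AtomisticToContinuum.Crystallization.Theorems.FrustratedLawDichotomyStrainedPatchGradedTube

/-! ## §0. The graded fine clause -/

/-- **`FineChartG T z c z₀ c₀ e`** — the deviation field is boxed PER HOST SITE on the whole `63/10`-ball: `‖dev a‖ ≤ T(z₀)(c₀)(e a)`. -/
def FineChartG (T : SlackTab) {M : ℕ} (z : Fin M → E3) (c : Fin M) {M₀ : ℕ} (z₀ : Fin M₀ → E3) (c₀ : Fin M₀) (e : Fin M → Fin M₀) : Prop :=
  ∀ a, dist (z a) (z c) ≤ 63 / 10 → ‖dev z c z₀ c₀ e a‖ ≤ T M₀ z₀ c₀ (e a)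

section Fine

variable {𝓘 : ChartFam} {τ δ : ℝ} {T T' : SlackTab} {M : ℕ} {z : Fin M → E3} {c : Fin M} {M₀ : ℕ} {z₀ : Fin M₀ → E3} {c₀ : Fin M₀} {e : Fin M → Fin M₀}

/-- At the constant table the graded fine clause IS `FineChart`. [formal bookkeeping] -/
theorem fineChartG_constTol_iff : FineChartG (constTol δ) z c z₀ c₀ e ↔ FineChart δ z c z₀ c₀ e := Iff.rfl

/-- The graded fine clause loosens with the table. [formal bookkeeping] -/
theorem FineChartG.mono_tol (h : FineChartG T z c z₀ c₀ e) (hle : TolLE T T') : FineChartG T' z c z₀ c₀ e :=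
  fun a ha => (h a ha).trans (hle M₀ z₀ c₀ (e a))

/-- `FineChart δ` gives the graded clause at every table nowhere below `δ`. [formal bookkeeping] -/
theorem fineChartG_of_fineChart (h : FineChart δ z c z₀ c₀ e) (hT : TolLE (constTol δ) T) : FineChartG T z c z₀ c₀ e :=
  (fineChartG_constTol_iff.2 h).mono_tol hT

/-- The profile clause of a graded chart in `dev` form. [formal bookkeeping] -/
theorem fineChartG_of_chartByG (h : ChartByG 𝓘 τ T z c z₀ c₀ e) : FineChartG T z c z₀ c₀ e := fun a ha => by
  rw [dev, ← dist_eq_norm]; exact h.2 a ha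

/-- A scalar chart with the graded fine clause is a graded chart. [formal bookkeeping] -/
theorem chartByG_of_fineChartG (h : ChartBy 𝓘 τ τ z c z₀ c₀ e) (hg : FineChartG T z c z₀ c₀ e) : ChartByG 𝓘 τ T z c z₀ c₀ e :=
  ⟨h, fun a ha => by rw [dist_eq_norm]; exact hg a ha⟩

/-- ★ `ChartByG ↔ ChartBy ∧ FineChartG`: the grading is exactly one extra binder on the record's cluster formats. [formal bookkeeping] -/
theorem chartByG_iff_fineChartG : ChartByG 𝓘 τ T z c z₀ c₀ e ↔ ChartBy 𝓘 τ τ z c z₀ c₀ e ∧ FineChartG T z c z₀ c₀ e :=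
  ⟨fun h => ⟨h.1, fineChartG_of_chartByG h⟩, fun h => chartByG_of_fineChartG h.1 h.2⟩

end Fine

/-! ## §1. The graded cluster formats and the graded row-priced descent -/

/-- ★ **(PTOP-G) `PriceTopTabG 𝓘 τ T Φ P`** [arithmetic · INSTRUMENTABLE] — `PriceTopTab` with the extra binder `FineChartG T`: the per-row a-priori level
on graded-charted admissible tube states. -/
def PriceTopTabG (𝓘 : ChartFam) (τ : ℝ) (T : SlackTab) (Φ : RowPrice) (P : SlackTab) : Prop :=
  ∀ (M : ℕ) (z : Fin M → E3) (c : Fin M) (M₀ : ℕ) (z₀ : Fin M₀ → E3) (c₀ : Fin M₀) (e : Fin M → Fin M₀) (t : ℝ),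
    Admissible M z c → CleanBall (63 / 10) z c → MonoPhaseBall (63 / 10) z c → 0 ≤ t → t ≤ constLaw τ M₀ z₀ c₀ → ChartBy 𝓘 τ t z c z₀ c₀ e →
      FineChart τ z c z₀ c₀ e → FineChartG T z c z₀ c₀ e → ∀ a ∈ ball (63 / 10) z c, IsReach z c a → Φ M z c M₀ z₀ c₀ e a ≤ P M₀ z₀ c₀ (e a)

/-- ★ **(PSTEP-G) `PriceStepTabG 𝓘 τ T σ Φ H F Y P`** [INSTRUMENTABLE — one constrained sup per row per host cell over tube ∩ GRADED box ∩ `P₀(Y)`]. -/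
def PriceStepTabG (𝓘 : ChartFam) (τ : ℝ) (T : SlackTab) (σ : ℝ) (Φ : RowPrice) (H : HessTab) (F : ForceTab) (Y P : SlackTab) : Prop :=
  ∀ (M : ℕ) (z : Fin M → E3) (c : Fin M) (M₀ : ℕ) (z₀ : Fin M₀ → E3) (c₀ : Fin M₀) (e : Fin M → Fin M₀) (t : ℝ),
    Admissible M z c → CleanBall (63 / 10) z c → MonoPhaseBall (63 / 10) z c → 0 ≤ t → t ≤ constLaw τ M₀ z₀ c₀ → ChartBy 𝓘 τ t z c z₀ c₀ e →
      FineChart τ z c z₀ c₀ e → FineChartG T z c z₀ c₀ e → InForcePolytope 0 σ H F Y z c z₀ c₀ e →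
        ∀ a ∈ ball (63 / 10) z c, IsReach z c a → Φ M z c M₀ z₀ c₀ e a ≤ P M₀ z₀ c₀ (e a)

/-- ★ **(CERT-G) `SlackCertG 𝓘 τ T κ σ H F X`** [INSTRUMENTABLE — the census LP over tube ∩ GRADED box ∩ `κ`-inflated polytope, row slack
`(1 + κ)σ + X`] — the score claim for graded-charted admissible clean mono-phase clusters in the polytope. -/
def SlackCertG (𝓘 : ChartFam) (τ : ℝ) (T : SlackTab) (κ σ : ℝ) (H : HessTab) (F : ForceTab) (X : SlackTab) : Prop :=
  ∀ (M : ℕ) (z : Fin M → E3) (c : Fin M) (M₀ : ℕ) (z₀ : Fin M₀ → E3) (c₀ : Fin M₀) (e : Fin M → Fin M₀),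
    Admissible M z c → CleanBall (63 / 10) z c → MonoPhaseBall (63 / 10) z c → ChartByG 𝓘 τ T z c z₀ c₀ e →
      InForcePolytope κ σ H F X z c z₀ c₀ e → 0 ≤ ballAvg (9 / 5) z (xRec M z) c

section Cluster

variable {𝓘 : ChartFam} {τ σ κ : ℝ} {T T' : SlackTab} {Φ : RowPrice} {H : HessTab} {F : ForceTab} {X Y P : SlackTab}

/-- The record's per-row top is a graded top at EVERY table (the box binder unused): (PTOP-G) is WEAKER. [formal bookkeeping] -/
theorem priceTopTabG_of_priceTopTab (T : SlackTab) (h : PriceTopTab 𝓘 τ Φ P) : PriceTopTabG 𝓘 τ T Φ P :=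
  fun M z c M₀ z₀ c₀ e t hz hcl hm ht htT hch hf _ => h M z c M₀ z₀ c₀ e t hz hcl hm ht htT hch hf

/-- … likewise the per-row step. [formal bookkeeping] -/
theorem priceStepTabG_of_priceStepTab (T : SlackTab) (h : PriceStepTab 𝓘 τ σ Φ H F Y P) : PriceStepTabG 𝓘 τ T σ Φ H F Y P :=
  fun M z c M₀ z₀ c₀ e t hz hcl hm ht htT hch hf _ hP => h M z c M₀ z₀ c₀ e t hz hcl hm ht htT hch hf hP

/-- … likewise the terminal certificate. [formal bookkeeping] -/
theorem slackCertG_of_slackCert (T : SlackTab) (h : SlackCert 𝓘 τ κ σ H F X) : SlackCertG 𝓘 τ T κ σ H F X :=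
  fun M z c M₀ z₀ c₀ e hz hcl hm hch hP => h M z c M₀ z₀ c₀ e hz hcl hm hch.1 hP

/-- The graded formats are ANTITONE in the table: certified on a looser box, they serve every tighter one. [formal bookkeeping] -/
theorem PriceTopTabG.anti_tol (h : PriceTopTabG 𝓘 τ T' Φ P) (hle : TolLE T T') : PriceTopTabG 𝓘 τ T Φ P :=
  fun M z c M₀ z₀ c₀ e t hz hcl hm ht htT hch hf hg => h M z c M₀ z₀ c₀ e t hz hcl hm ht htT hch hf (hg.mono_tol hle)
/-- See `PriceTopTabG.anti_tol`. [formal bookkeeping] -/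
theorem PriceStepTabG.anti_tol (h : PriceStepTabG 𝓘 τ T' σ Φ H F Y P) (hle : TolLE T T') : PriceStepTabG 𝓘 τ T σ Φ H F Y P :=
  fun M z c M₀ z₀ c₀ e t hz hcl hm ht htT hch hf hg => h M z c M₀ z₀ c₀ e t hz hcl hm ht htT hch hf (hg.mono_tol hle)
/-- See `PriceTopTabG.anti_tol`. [formal bookkeeping] -/
theorem SlackCertG.anti_tol (h : SlackCertG 𝓘 τ T' κ σ H F X) (hle : TolLE T T') : SlackCertG 𝓘 τ T κ σ H F X :=
  fun M z c M₀ z₀ c₀ e hz hcl hm hch => h M z c M₀ z₀ c₀ e hz hcl hm (hch.mono_tol hle)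

/-- At any table nowhere below the scalar the graded formats give back the record's. [formal bookkeeping] -/
theorem priceTopTab_of_priceTopTabG (h : PriceTopTabG 𝓘 τ T Φ P) (hT : TolLE (constTol τ) T) : PriceTopTab 𝓘 τ Φ P :=
  fun M z c M₀ z₀ c₀ e t hz hcl hm ht htT hch hf => h M z c M₀ z₀ c₀ e t hz hcl hm ht htT hch hf (fineChartG_of_fineChart hf hT)
/-- See `priceTopTab_of_priceTopTabG`. [formal bookkeeping] -/
theorem priceStepTab_of_priceStepTabG (h : PriceStepTabG 𝓘 τ T σ Φ H F Y P) (hT : TolLE (constTol τ) T) : PriceStepTab 𝓘 τ σ Φ H F Y P :=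
  fun M z c M₀ z₀ c₀ e t hz hcl hm ht htT hch hf => h M z c M₀ z₀ c₀ e t hz hcl hm ht htT hch hf (fineChartG_of_fineChart hf hT)
/-- See `priceTopTab_of_priceTopTabG`. [formal bookkeeping] -/
theorem slackCert_of_slackCertG (h : SlackCertG 𝓘 τ T κ σ H F X) (hT : TolLE (constTol τ) T) : SlackCert 𝓘 τ κ σ H F X :=
  fun M z c M₀ z₀ c₀ e hz hcl hm hch => h M z c M₀ z₀ c₀ e hz hcl hm (chartByG_of_chartBy hch fun b => hT M₀ z₀ c₀ b)

/-- ★ At the constant table the three graded formats ARE the record's. [formal bookkeeping] -/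
theorem priceTopTabG_constTol_iff : PriceTopTabG 𝓘 τ (constTol τ) Φ P ↔ PriceTopTab 𝓘 τ Φ P :=
  ⟨fun h => priceTopTab_of_priceTopTabG h (TolLE.refl _), priceTopTabG_of_priceTopTab _⟩
/-- See `priceTopTabG_constTol_iff`. [formal bookkeeping] -/
theorem priceStepTabG_constTol_iff : PriceStepTabG 𝓘 τ (constTol τ) σ Φ H F Y P ↔ PriceStepTab 𝓘 τ σ Φ H F Y P :=
  ⟨fun h => priceStepTab_of_priceStepTabG h (TolLE.refl _), priceStepTabG_of_priceStepTab _⟩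
/-- See `priceTopTabG_constTol_iff`. [formal bookkeeping] -/
theorem slackCertG_constTol_iff : SlackCertG 𝓘 τ (constTol τ) κ σ H F X ↔ SlackCert 𝓘 τ κ σ H F X :=
  ⟨fun h => slackCert_of_slackCertG h (TolLE.refl _), slackCertG_of_slackCert _⟩

/-- A graded top is a graded step on every column. [formal bookkeeping] -/
theorem priceStepTabG_of_priceTopTabG (σ : ℝ) (H : HessTab) (F : ForceTab) (Y : SlackTab) (h : PriceTopTabG 𝓘 τ T Φ P) :
    PriceStepTabG 𝓘 τ T σ Φ H F Y P :=
  fun M z c M₀ z₀ c₀ e t hz hcl hm ht htT hch hf hg _ => h M z c M₀ z₀ c₀ e t hz hcl hm ht htT hch hf hg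

/-- (TF-G) ⟹ (CERT-G) at every slack: the graded certificate is never stronger than the graded claim it serves. [formal bookkeeping] -/
theorem slackCertG_of_tubeFloorG (κ σ : ℝ) (H : HessTab) (F : ForceTab) (X : SlackTab) (h : TubeFloorG 𝓘 τ T) : SlackCertG 𝓘 τ T κ σ H F X :=
  fun M z c M₀ z₀ c₀ e hz hcl hm hch _ => h M z c M₀ z₀ c₀ e hz hcl hm hch

/-- ★★★ **THE GRADED ROW-PRICED DESCENT** — an (ungraded) priced charge `Φ` with column `X`, the graded per-row START table `P 0`, a finite sequence
of graded per-row steps on the columns `addCol X (P i)`, and the graded terminal certificate on `addCol X (P n)` give **(TF-G) `TubeFloorG 𝓘 τ T`**.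
[formal bookkeeping: R1⁗'s induction over the tree's `forceCapOne`, the box binder `FineChartG T` (from `ChartByG`) carried along] -/
theorem tubeFloorG_of_pricedCharge_of_tabDescentG (P : ℕ → SlackTab) (n : ℕ) (hτ : 0 ≤ τ) (hS : PricedCharge 𝓘 τ Φ X)
    (h0 : PriceTopTabG 𝓘 τ T Φ (P 0)) (hs : ∀ i : ℕ, i < n → PriceStepTabG 𝓘 τ T sigmaOne Φ hessBlk0 force0 (addCol X (P i)) (P (i + 1)))
    (hC : SlackCertG 𝓘 τ T 0 sigmaOne hessBlk0 force0 (addCol X (P n))) : TubeFloorG 𝓘 τ T := by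
  intro M z c M₀ z₀ c₀ e hz hcl hm hchG
  have hch : ChartBy 𝓘 τ τ z c z₀ c₀ e := hchG.1
  have hf : FineChart τ z c z₀ c₀ e := fineChart_of_chartBy hch
  have hg : FineChartG T z c z₀ c₀ e := fineChartG_of_chartByG hchG
  have hcap : ∀ a ∈ ball (63 / 10) z c, IsReach z c a → ‖siteForce 7 z a‖ ≤ sigmaOne := fun a _ hr => forceCapOne M z c hz a hr
  have hrem : ∀ a ∈ ball (63 / 10) z c, IsReach z c a →
      ‖siteForce 7 z a - linForce hessBlk0 force0 z c z₀ c₀ e a‖ ≤ Φ M z c M₀ z₀ c₀ e a + X M₀ z₀ c₀ (e a) :=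
    fun a ha hr => hS M z c M₀ z₀ c₀ e τ hz hcl hm hτ le_rfl hch hf a ha hr
  have key : ∀ i : ℕ, i ≤ n → InForcePolytope 0 sigmaOne hessBlk0 force0 (addCol X (P i)) z c z₀ c₀ e := by
    intro i
    induction i with
    | zero => exact fun _ => inForcePolytope_addCol_of_cap_of_rem hcap hrem fun a ha hr => h0 M z c M₀ z₀ c₀ e τ hz hcl hm hτ le_rfl hch hf hg a ha hr
    | succ i ih =>
        exact fun hi => inForcePolytope_addCol_of_cap_of_rem hcap hrem fun a ha hr =>
          hs i (Nat.lt_of_succ_le hi) M z c M₀ z₀ c₀ e τ hz hcl hm hτ le_rfl hch hf hg (ih (Nat.le_of_succ_le hi)) a ha hr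
  exact hC M z c M₀ z₀ c₀ e hz hcl hm hchG (key n le_rfl)

/-- ★★ **[CORE-FAR] FROM THE GRADED DESCENT AND THE GRADED COVER** at any family, scalar and table (g77's junction). [formal bookkeeping] -/
theorem coreOff_of_tabDescentG (P : ℕ → SlackTab) (n : ℕ) (hτ : 0 ≤ τ) (hS : PricedCharge 𝓘 τ Φ X) (h0 : PriceTopTabG 𝓘 τ T Φ (P 0))
    (hs : ∀ i : ℕ, i < n → PriceStepTabG 𝓘 τ T sigmaOne Φ hessBlk0 force0 (addCol X (P i)) (P (i + 1)))
    (hC : SlackCertG 𝓘 τ T 0 sigmaOne hessBlk0 force0 (addCol X (P n))) (hcov : FamilyCoverG 𝓘 (24 / 5) (1 / 100) (1 / 8) τ T) :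
    CoreOffTubeFloor (63 / 10) (63 / 10) (24 / 5) (1 / 100) 0 :=
  coreOff_of_tubeFloorG_of_coverG_eighth (tubeFloorG_of_pricedCharge_of_tabDescentG P n hτ hS h0 hs hC) hcov

/-- ★ (R2) RECOVERY: R1⁗ (`…RowPrice.tubeFloor_of_pricedCharge_of_tabDescent`) IS the constant-table instance of the graded descent. [formal bookkeeping] -/
theorem tubeFloor_of_tabDescent_via_graded (P : ℕ → SlackTab) (n : ℕ) (hτ : 0 ≤ τ) (hS : PricedCharge 𝓘 τ Φ X) (h0 : PriceTopTab 𝓘 τ Φ (P 0))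
    (hs : ∀ i : ℕ, i < n → PriceStepTab 𝓘 τ sigmaOne Φ hessBlk0 force0 (addCol X (P i)) (P (i + 1)))
    (hC : SlackCert 𝓘 τ 0 sigmaOne hessBlk0 force0 (addCol X (P n))) : TubeFloor 𝓘 τ :=
  tubeFloorG_constTol_iff.1 (tubeFloorG_of_pricedCharge_of_tabDescentG P n hτ hS (priceTopTabG_of_priceTopTab _ h0)
    (fun i hi => priceStepTabG_of_priceStepTab _ (hs i hi)) (slackCertG_of_slackCert _ hC))

end Cluster

/-! ## §2. The graded host reading and the graded host tables -/

/-- **`HostReadingG τ T z₀ c₀ O D`** — an admissible host reading whose displacement field is ADDITIONALLY boxed per host site: `‖D h‖ ≤ T(z₀)(c₀)(h)` on `O`. -/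
def HostReadingG (τ : ℝ) (T : SlackTab) {M₀ : ℕ} (z₀ : Fin M₀ → E3) (c₀ : Fin M₀) (O : Finset (Fin M₀)) (D : Fin M₀ → E3) : Prop :=
  HostReading τ z₀ c₀ O D ∧ ∀ h ∈ O, ‖D h‖ ≤ T M₀ z₀ c₀ h

section Reading

variable {τ : ℝ} {T T' : SlackTab} {M₀ : ℕ} {z₀ : Fin M₀ → E3} {c₀ : Fin M₀} {O : Finset (Fin M₀)} {D : Fin M₀ → E3}

/-- The graded reading loosens with the table. [formal bookkeeping] -/
theorem HostReadingG.mono_tol (h : HostReadingG τ T z₀ c₀ O D) (hle : TolLE T T') : HostReadingG τ T' z₀ c₀ O D :=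
  ⟨h.1, fun h₀ hh => (h.2 h₀ hh).trans (hle M₀ z₀ c₀ h₀)⟩

/-- A reading of record is a graded reading at every table nowhere below `τ`. [formal bookkeeping] -/
theorem hostReadingG_of_hostReading (h : HostReading τ z₀ c₀ O D) (hT : TolLE (constTol τ) T) : HostReadingG τ T z₀ c₀ O D :=
  ⟨h, fun h₀ hh => (h.2.2.2.1 h₀ hh).trans (hT M₀ z₀ c₀ h₀)⟩

/-- ★ At the constant table the graded reading IS the reading of record. [formal bookkeeping] -/
theorem hostReadingG_constTol_iff : HostReadingG τ (constTol τ) z₀ c₀ O D ↔ HostReading τ z₀ c₀ O D :=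
  ⟨fun h => h.1, fun h => hostReadingG_of_hostReading h (TolLE.refl _)⟩

end Reading

/-- ★ **A GRADED `τ`-CHART READS AS A GRADED HOST READING.** [formal bookkeeping: `hostReading_of_chart` + `disp (e a) = dev a`] -/
theorem hostReadingG_of_chart {𝓘 : ChartFam} {τ t : ℝ} {T : SlackTab} {M : ℕ} {z : Fin M → E3} {c : Fin M} {M₀ : ℕ} {z₀ : Fin M₀ → E3} {c₀ : Fin M₀}
    {e : Fin M → Fin M₀} (hch : ChartBy 𝓘 τ t z c z₀ c₀ e) (hf : FineChart τ z c z₀ c₀ e) (hg : FineChartG T z c z₀ c₀ e) :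
    HostReadingG τ T z₀ c₀ (occ z c e) (disp z c z₀ c₀ e) := by
  refine ⟨hostReading_of_chart hch hf, fun h hh => ?_⟩
  have hinj : ∀ b b', b ∈ ball (63 / 10) z c → b' ∈ ball (63 / 10) z c → e b = e b' → b = b' := fun b b' hb hb' hE =>
    hch.2.2.2.2.1 b b' (mem_ball.1 hb) (mem_ball.1 hb') hE
  obtain ⟨a, ha, rfl⟩ := mem_occ.1 hh
  rw [disp_apply hinj ha]
  exact hg a (mem_ball.1 ha)

/-- ★ **(HTOP-G) `HostTopTabG 𝓘 τ T B tl r P`** [INSTRUMENTABLE · per host — the graded START table]: on every GRADED admissible host reading the host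
quadratic price of every maybe-reach row `h` is `≤ P(z₀)(h)`. -/
def HostTopTabG (𝓘 : ChartFam) (τ : ℝ) (T : SlackTab) (B : E3 → E3 →L[ℝ] E3 →L[ℝ] E3) (tl : ℝ → ℝ → ℝ) (r : ℝ) (P : SlackTab) : Prop :=
  ∀ (M₀ : ℕ) (z₀ : Fin M₀ → E3) (c₀ : Fin M₀), 𝓘 M₀ z₀ c₀ → ∀ (O : Finset (Fin M₀)) (D : Fin M₀ → E3), HostReadingG τ T z₀ c₀ O D →
    ∀ h ∈ O, HostMaybeReach τ z₀ c₀ O h → hostQuad B tl r z₀ O D h ≤ P M₀ z₀ c₀ h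

/-- ★ **(HSTEP-G) `HostStepTabG 𝓘 τ T σ B tl r H F Y P`** [INSTRUMENTABLE · ONE constrained sup PER ROW per host cell over the GRADED global polytope]. -/
def HostStepTabG (𝓘 : ChartFam) (τ : ℝ) (T : SlackTab) (σ : ℝ) (B : E3 → E3 →L[ℝ] E3 →L[ℝ] E3) (tl : ℝ → ℝ → ℝ) (r : ℝ) (H : HessTab) (F : ForceTab)
    (Y P : SlackTab) : Prop :=
  ∀ (M₀ : ℕ) (z₀ : Fin M₀ → E3) (c₀ : Fin M₀), 𝓘 M₀ z₀ c₀ → ∀ (O : Finset (Fin M₀)) (D : Fin M₀ → E3), HostReadingG τ T z₀ c₀ O D →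
    (∀ h ∈ O, HostSureReach τ z₀ c₀ O h → ‖hostLin H F z₀ c₀ O D h‖ ≤ σ + Y M₀ z₀ c₀ h) →
      ∀ h ∈ O, HostMaybeReach τ z₀ c₀ O h → hostQuad B tl r z₀ O D h ≤ P M₀ z₀ c₀ h

section Host

variable {𝓘 : ChartFam} {τ σ : ℝ} {T T' : SlackTab} {B : E3 → E3 →L[ℝ] E3 →L[ℝ] E3} {tl : ℝ → ℝ → ℝ} {r : ℝ} {H : HessTab} {F : ForceTab} {Y P : SlackTab}

/-- The record's host tables are graded host tables at every `T`; the graded ones are ANTITONE in `T` and give back the record's at `T ≥ τ`. -/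
theorem hostTopTabG_of_hostTopTab (T : SlackTab) (h : HostTopTab 𝓘 τ B tl r P) : HostTopTabG 𝓘 τ T B tl r P :=
  fun M₀ z₀ c₀ hI O D hR => h M₀ z₀ c₀ hI O D hR.1
/-- See `hostTopTabG_of_hostTopTab`. [formal bookkeeping] -/
theorem hostStepTabG_of_hostStepTab (T : SlackTab) (h : HostStepTab 𝓘 τ σ B tl r H F Y P) : HostStepTabG 𝓘 τ T σ B tl r H F Y P :=
  fun M₀ z₀ c₀ hI O D hR => h M₀ z₀ c₀ hI O D hR.1
/-- See `hostTopTabG_of_hostTopTab`. [formal bookkeeping] -/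
theorem HostTopTabG.anti_tol (h : HostTopTabG 𝓘 τ T' B tl r P) (hle : TolLE T T') : HostTopTabG 𝓘 τ T B tl r P :=
  fun M₀ z₀ c₀ hI O D hR => h M₀ z₀ c₀ hI O D (hR.mono_tol hle)
/-- See `hostTopTabG_of_hostTopTab`. [formal bookkeeping] -/
theorem HostStepTabG.anti_tol (h : HostStepTabG 𝓘 τ T' σ B tl r H F Y P) (hle : TolLE T T') : HostStepTabG 𝓘 τ T σ B tl r H F Y P :=
  fun M₀ z₀ c₀ hI O D hR => h M₀ z₀ c₀ hI O D (hR.mono_tol hle)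
/-- See `hostTopTabG_of_hostTopTab`. [formal bookkeeping] -/
theorem hostTopTab_of_hostTopTabG (h : HostTopTabG 𝓘 τ T B tl r P) (hT : TolLE (constTol τ) T) : HostTopTab 𝓘 τ B tl r P :=
  fun M₀ z₀ c₀ hI O D hR => h M₀ z₀ c₀ hI O D (hostReadingG_of_hostReading hR hT)
/-- See `hostTopTabG_of_hostTopTab`. [formal bookkeeping] -/
theorem hostStepTab_of_hostStepTabG (h : HostStepTabG 𝓘 τ T σ B tl r H F Y P) (hT : TolLE (constTol τ) T) : HostStepTab 𝓘 τ σ B tl r H F Y P :=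
  fun M₀ z₀ c₀ hI O D hR => h M₀ z₀ c₀ hI O D (hostReadingG_of_hostReading hR hT)

/-- A graded host top is a graded host step on every column. [formal bookkeeping] -/
theorem hostStepTabG_of_hostTopTabG (h : HostTopTabG 𝓘 τ T B tl r P) (σ : ℝ) (H : HessTab) (F : ForceTab) (Y : SlackTab) :
    HostStepTabG 𝓘 τ T σ B tl r H F Y P :=
  fun M₀ z₀ c₀ hI O D hR _ => h M₀ z₀ c₀ hI O D hR

/-- ★★ **`priceTopTabG_of_hostTopTabG`** — (HTOP-G P) ⟹ (PTOP-G P) for `Φ = quadPrice B tl r`. [formal bookkeeping over `hostReadingG_of_chart`] -/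
theorem priceTopTabG_of_hostTopTabG (hH : HostTopTabG 𝓘 τ T B tl r P) : PriceTopTabG 𝓘 τ T (quadPrice B tl r) P := by
  intro M z c M₀ z₀ c₀ e t hz hcl hm ht htT hch hf hg a ha hr
  have hinj : ∀ b b', b ∈ ball (63 / 10) z c → b' ∈ ball (63 / 10) z c → e b = e b' → b = b' := fun b b' hb hb' hE =>
    hch.2.2.2.2.1 b b' (mem_ball.1 hb) (mem_ball.1 hb') hE
  rw [quadPrice_eq_hostQuad B tl r hinj ha]
  exact hH M₀ z₀ c₀ hch.1 _ _ (hostReadingG_of_chart hch hf hg) (e a) (mem_occ_of_mem ha) (hostMaybeReach_of_isReach hf ha hr)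

/-- ★★★ **`priceStepTabG_of_hostStepTabG`** — (HSTEP-G Y P) ⟹ (PSTEP-G Y P) for `Φ = quadPrice B tl r` (polytope rows ↦ SURE-reach host rows; conclusion
back from the MAYBE-reach rows). [formal bookkeeping over `hostReadingG_of_chart`] -/
theorem priceStepTabG_of_hostStepTabG (hH : HostStepTabG 𝓘 τ T σ B tl r H F Y P) : PriceStepTabG 𝓘 τ T σ (quadPrice B tl r) H F Y P := by
  intro M z c M₀ z₀ c₀ e t hz hcl hm ht htT hch hf hg hP a ha hr
  have hinj : ∀ b b', b ∈ ball (63 / 10) z c → b' ∈ ball (63 / 10) z c → e b = e b' → b = b' := fun b b' hb hb' hE =>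
    hch.2.2.2.2.1 b b' (mem_ball.1 hb) (mem_ball.1 hb') hE
  rw [quadPrice_eq_hostQuad B tl r hinj ha]
  refine hH M₀ z₀ c₀ hch.1 _ _ (hostReadingG_of_chart hch hf hg) (fun h hh hs => ?_) (e a) (mem_occ_of_mem ha) (hostMaybeReach_of_isReach hf ha hr)
  obtain ⟨a', ha', rfl, hr'⟩ := isReach_of_hostSureReach hf hh hs
  rw [← linForce_eq_hostLin H F hinj a']
  have h₁ := hP a' ha' hr'
  linarith

/-- ★★★ (TF-G) from the per-row GRADED HOST TABLES and the general bond data of R1⁗ (unchanged). [formal bookkeeping: §1 + the two soundness lemmas] -/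
theorem tubeFloorG_of_hostTabsG {s₀ : ℝ} {L : ℝ → ℝ} {X : SlackTab} (P : ℕ → SlackTab) (n : ℕ) (hτ : 0 ≤ τ) (hC : BondHessLip B L s₀ r (2 * τ))
    (hsep : HostSep 𝓘 s₀) (hX : FarColumn 𝓘 τ r X) (h0 : HostTopTabG 𝓘 τ T B (cubicTail L) r (P 0))
    (hs : ∀ i : ℕ, i < n → HostStepTabG 𝓘 τ T sigmaOne B (cubicTail L) r hessBlk0 force0 (addCol X (P i)) (P (i + 1)))
    (hcert : SlackCertG 𝓘 τ T 0 sigmaOne hessBlk0 force0 (addCol X (P n))) : TubeFloorG 𝓘 τ T :=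
  tubeFloorG_of_pricedCharge_of_tabDescentG P n hτ (pricedCharge_quadPrice_of_bondHessLip hC hsep hX) (priceTopTabG_of_hostTopTabG h0)
    (fun i hi => priceStepTabG_of_hostStepTabG (hs i hi)) hcert

end Host

end Summit.AtomisticToContinuum.Crystallization.Theorems.FrustratedLawDichotomyStrainedPatchGradedDescent
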